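import Literature.AlgebraicGeometry.Motives.HodgeLieWeightOneSl2CenterVanishing
import HarnessLib

/-!
# Weight-one Hodge structures whose Hodge Lie algebra has a three-dimensional derived algebra and ARBITRARY centre.
# E: ranks of the `𝔰𝔩₂`-data and descent for the corner of `End_Hdg(V)` at the rational projector `p`

Family `hodge`, layer `Literature/AlgebraicGeometry/Motives`; THEOREMS ONLY (no definition, no named fact; D-0026).
Fifth abstract file of the lane MT-RANK-SIX-ISOGENY of the cell `pub-hodgecm2` (COR-CM), seat `b27` (setting as in
`Motives/HodgeLieWeightOneSl2Center{,Commutator,Splitting,Vanishing}`).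

* §7 `rank_identities` — `rk E = rk F = rk(Pπ) = rk((1−P)π)` and `rk π = 2 rk(Pπ)` (`E F E = αE`, `F E F = αF`,
  `E F = αPπ`, `F E = α(π − Pπ)`); `finrank_range_baseChange_eq` — `rk_ℂ p_ℂ = rk_ℚ p`.
* §8 `corner_descent` — every `T` commuting with `E, F` with `Tπ = T` lies in the complex span of
  `{a_ℂ | a ∈ End_Hdg(V), a p = a}` (commutant descent, as in `center_mul_projector_eq_zero`).  The sequels
  `Motives/HodgeLieWeightOneSl2CenterCornerDimension`, `…Structure` derive `4 · dim_ℚ {a ∈ End_Hdg | a p = a} = (rk p)²`,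
  the centre `ℚ p` of that corner, the description of `{a ∈ End_Hdg | a p = 0}`, and the basis-free structure theorem.

## References

* [MoonenZarhin1999LowDim] B. Moonen, Yu. Zarhin, *Hodge classes on abelian varieties of low dimension*, Math. Ann. 315
  (1999), §2.
* [Deligne1982HodgeCycles] P. Deligne, *Hodge cycles on abelian varieties*, LNM 900 (1982), I §3 (3.1–3.7).
* [Zarhin1983HodgeGroupsK3] Yu. G. Zarhin, *Hodge groups of K3 surfaces*, J. reine angew. Math. 341 (1983), §2.
* [FultonHarris1991] W. Fulton, J. Harris, *Representation Theory*, GTM 129 (1991), Lecture 11 (§11.1).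
* [Humphreys1972] J. E. Humphreys, *Introduction to Lie Algebras and Representation Theory*, GTM 9 (1972), §6.1.
-/

noncomputable section

open scoped TensorProduct

namespace Literature.AlgebraicGeometry.Motives

universe u

namespace HodgeStructure

open ProjectorBlocks Literature.RepresentationTheory.GeneralLinear

variable {V : Type u} [AddCommGroup V] [Module ℚ V] [Module.Finite ℚ V] [HodgeTensorFacts.{u, u}] {n : ℤ}
  {S : Type u} [Fintype S] [DecidableEq S] {deg : S → ℤ}

/-! ## §7 Ranks -/

omit [HodgeTensorFacts.{u, u}] [Fintype S] [DecidableEq S] in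
/-- Orthogonal commuting idempotents have `rk(e₁ + e₂) = rk e₁ + rk e₂` (`range (e₁ + e₂) = range e₁ ⊕ range e₂`).
[cite: Humphreys1972, §6.1] -/
theorem finrank_range_add_of_orthogonal {W : Type*} [AddCommGroup W] [Module ℂ W] [FiniteDimensional ℂ W]
    {e₁ e₂ : Module.End ℂ W} (h₁ : e₁ * e₁ = e₁) (h₂ : e₂ * e₂ = e₂) (h₁₂ : e₁ * e₂ = 0) (h₂₁ : e₂ * e₁ = 0) :
    Module.finrank ℂ (LinearMap.range (e₁ + e₂)) =
      Module.finrank ℂ (LinearMap.range e₁) + Module.finrank ℂ (LinearMap.range e₂) := by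
  have hsup : LinearMap.range (e₁ + e₂) = LinearMap.range e₁ ⊔ LinearMap.range e₂ := by
    apply le_antisymm
    · rintro _ ⟨w, rfl⟩
      rw [LinearMap.add_apply]
      exact Submodule.add_mem_sup (LinearMap.mem_range_self _ _) (LinearMap.mem_range_self _ _)
    · refine sup_le ?_ ?_
      · rintro _ ⟨w, rfl⟩
        refine ⟨e₁ w, ?_⟩
        rw [LinearMap.add_apply, ← Module.End.mul_apply, ← Module.End.mul_apply, h₁, h₂₁, LinearMap.zero_apply, add_zero]
      · rintro _ ⟨w, rfl⟩
        refine ⟨e₂ w, ?_⟩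
        rw [LinearMap.add_apply, ← Module.End.mul_apply, ← Module.End.mul_apply, h₁₂, h₂, LinearMap.zero_apply, zero_add]
  have hinf : LinearMap.range e₁ ⊓ LinearMap.range e₂ = ⊥ := by
    rw [Submodule.eq_bot_iff]
    rintro y ⟨⟨a, rfl⟩, ⟨b, hb⟩⟩
    have h : e₁ (e₁ a) = e₁ (e₂ b) := by rw [hb]
    rw [← Module.End.mul_apply, h₁, ← Module.End.mul_apply, h₁₂, LinearMap.zero_apply] at h
    exact h
  have h := Submodule.finrank_sup_add_finrank_inf_eq (LinearMap.range e₁) (LinearMap.range e₂)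
  rw [hinf, finrank_bot, add_zero, ← hsup] at h
  exact h

omit [HodgeTensorFacts.{u, u}] [Fintype S] [DecidableEq S] in
/-- `rk_ℂ p_ℂ = rk_ℚ p` for a rational endomorphism (`ker p_ℂ = (ker p)_ℂ`, base change preserves dimensions).
[cite: Deligne1982HodgeCycles, I §3 (proof of Prop. 3.4)] -/
theorem finrank_range_baseChange_eq (p : Module.End ℚ V) :
    Module.finrank ℂ (LinearMap.range (p.baseChange ℂ)) = Module.finrank ℚ (LinearMap.range p) := by
  have hker : LinearMap.ker (p.baseChange ℂ) = (LinearMap.ker p).baseChange ℂ := by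
    ext x
    rw [LinearMap.mem_ker, mem_baseChange_ker_iff]
  have h1 := LinearMap.finrank_range_add_finrank_ker (p.baseChange ℂ)
  have h2 := LinearMap.finrank_range_add_finrank_ker p
  rw [hker, finrank_submodule_baseChange, Module.finrank_baseChange] at h1
  omega

omit [HodgeTensorFacts.{u, u}] in
/-- **Ranks of the `𝔰𝔩₂`-data**: `rk(Pπ) = rk E`, `rk(π − Pπ) = rk F`, `rk E = rk F`, `rk π = rk(Pπ) + rk(π − Pπ)`,
hence `rk π = 2 rk(Pπ)` (from `E F E = αE`, `F E F = αF`, `E F = αPπ`, `F E = α(π − Pπ)`, `π² = π`, `Pπ = πP`).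
[cite: FultonHarris1991, Lecture 11 (§11.1)] -/
theorem two_mul_finrank_range_corner_eq {P E F Q : Module.End ℂ (ℂ ⊗[ℚ] V)} {α : ℂ} (hα : α ≠ 0)
    (hPP : P * P = P) (hQQ : Q * Q = Q) (hPQ : P * Q = Q * P) (hEFE : E * F * E = α • E) (hFEF : F * E * F = α • F)
    (hEF : E * F = α • (P * Q)) (hFE : F * E = α • (Q - P * Q)) :
    2 * Module.finrank ℂ (LinearMap.range (P * Q)) = Module.finrank ℂ (LinearMap.range Q) := by
  -- `rk(PQ) = rk E`, `rk(Q - PQ) = rk F`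
  have hrE : LinearMap.range (P * Q) = LinearMap.range E := by
    have h1 : LinearMap.range (P * Q) = LinearMap.range (E * F) := by
      rw [hEF, LinearMap.range_smul _ _ hα]
    rw [h1]
    apply le_antisymm
    · rintro _ ⟨x, rfl⟩
      exact ⟨F x, rfl⟩
    · rintro _ ⟨x, rfl⟩
      refine ⟨α⁻¹ • E x, ?_⟩
      have h := LinearMap.congr_fun hEFE x
      rw [LinearMap.smul_apply, Module.End.mul_apply] at h
      rw [map_smul, h, smul_smul, inv_mul_cancel₀ hα, one_smul]
  have hrF : LinearMap.range (Q - P * Q) = LinearMap.range F := by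
    have h1 : LinearMap.range (Q - P * Q) = LinearMap.range (F * E) := by
      rw [hFE, LinearMap.range_smul _ _ hα]
    rw [h1]
    apply le_antisymm
    · rintro _ ⟨x, rfl⟩
      exact ⟨E x, rfl⟩
    · rintro _ ⟨x, rfl⟩
      refine ⟨α⁻¹ • F x, ?_⟩
      have h := LinearMap.congr_fun hFEF x
      rw [LinearMap.smul_apply, Module.End.mul_apply] at h
      rw [map_smul, h, smul_smul, inv_mul_cancel₀ hα, one_smul]
  -- `rk E = rk F`: `F` is injective on `range E` (`E F E = αE`) and conversely
  have hEF_le : ∀ {A B : Module.End ℂ (ℂ ⊗[ℚ] V)}, A * B * A = α • A →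
      Module.finrank ℂ (LinearMap.range A) ≤ Module.finrank ℂ (LinearMap.range B) := by
    intro A B hABA
    let f : LinearMap.range A →ₗ[ℂ] LinearMap.range B :=
      { toFun := fun x => ⟨B x, LinearMap.mem_range_self B x⟩
        map_add' := fun x y => Subtype.ext (by simp)
        map_smul' := fun c x => Subtype.ext (by simp) }
    refine LinearMap.finrank_le_finrank_of_injective (f := f) fun x y hxy => ?_
    obtain ⟨a, ha⟩ := x.2
    obtain ⟨b, hb⟩ := y.2
    apply Subtype.ext
    have h : B (x : ℂ ⊗[ℚ] V) = B y := congrArg Subtype.val hxy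
    have h' : (A * B * A) a = (A * B * A) b := by
      simp only [Module.End.mul_apply, ha, hb, h]
    rw [hABA, LinearMap.smul_apply, LinearMap.smul_apply, ha, hb] at h'
    exact smul_right_injective _ hα h'
  have hEF' : Module.finrank ℂ (LinearMap.range E) = Module.finrank ℂ (LinearMap.range F) :=
    le_antisymm (hEF_le hEFE) (hEF_le hFEF)
  -- `rk Q = rk(PQ) + rk(Q − PQ)`
  have hQPQ : Q * (P * Q) = P * Q := by rw [← mul_assoc, ← hPQ, mul_assoc, hQQ]
  have hPQQ : P * Q * Q = P * Q := by rw [mul_assoc, hQQ]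
  have hidem₁ : P * Q * (P * Q) = P * Q := by rw [mul_assoc, hQPQ, ← mul_assoc, hPP]
  have h12 : P * Q * (Q - P * Q) = 0 := by rw [mul_sub, hPQQ, hidem₁, sub_self]
  have h21 : (Q - P * Q) * (P * Q) = 0 := by rw [sub_mul, hQPQ, hidem₁, sub_self]
  have hidem₂ : (Q - P * Q) * (Q - P * Q) = Q - P * Q := by
    rw [sub_mul, mul_sub, mul_sub, hQQ, hQPQ, hPQQ, hidem₁, sub_self, sub_zero]
  have hsum := finrank_range_add_of_orthogonal hidem₁ hidem₂ h12 h21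
  rw [add_sub_cancel] at hsum
  rw [hsum, hrE, hrF, hEF']
  ring

/-! ## §8 The corner of `End_Hdg(V)` at `p`: descent, dimension `(rk p)²/4`, centre `ℚ p` -/

/-- **Corner descent**: a `ℂ`-linear `T` commuting with `E, F` with `Tπ = T` lies in the complex span of
`{a_ℂ | a ∈ End_Hdg(V), a p = a}` (`p` the rational idempotent with `p_ℂ = π`).  `T` commutes with the rational
brackets (`𝔡_ℂ = ℂE ⊕ ℂF ⊕ ℂ[E,F]`), so by commutant descent it is a combination of `b_ℂ` with `b` rational commuting
with `𝔡`; for such `b`, `α[b, 2P−1]π = [ζ₀, b]π = 0`, so `b p ∈ End_Hdg(V)` and `T = Tπ = Σ cᵢ (bᵢ p)_ℂ`.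
[cite: Zarhin1983HodgeGroupsK3, §2] [cite: Deligne1982HodgeCycles, I §3 (proof of Prop. 3.4)] -/
theorem corner_descent (H : HodgeStructure V n) (ψ : H.Polarization) (hn : n = 1)
    (e : Module.Basis S ℂ (ℂ ⊗[ℚ] V)) (hF : ∀ a, H.F a = Submodule.span ℂ (e '' {σ | a ≤ deg σ}))
    (hFc : ∀ a, complexConj (H.F a) = Submodule.span ℂ (e '' {σ | deg σ ≤ n - a}))
    (hdeg : ∀ σ, deg σ = 0 ∨ deg σ = 1) {X : Module.End ℚ V} (hX : X ∈ H.hodgeLie) (hXE : X ∉ H.endAlg)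
    (h3 : Module.finrank ℚ ↥(Submodule.span ℚ {B | ∃ X ∈ H.hodgeLie, ∃ Y ∈ H.hodgeLie, X * Y - Y * X = B}) = 3)
    {α : ℂ} (hα : α ≠ 0) {ζ₀ : Module.End ℂ (ℂ ⊗[ℚ] V)}
    (hζ₀ : ζ₀ ∈ spanC (H.hodgeLie ⊓ Subalgebra.toSubmodule H.endAlg))
    (hEF : (gradingEnd e deg * X.baseChange ℂ * (1 - gradingEnd e deg)) *
          ((1 - gradingEnd e deg) * X.baseChange ℂ * gradingEnd e deg) -
        ((1 - gradingEnd e deg) * X.baseChange ℂ * gradingEnd e deg) *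
          (gradingEnd e deg * X.baseChange ℂ * (1 - gradingEnd e deg)) =
        α • ((2 : ℂ) • gradingEnd e deg - 1) + ζ₀)
    {Q : Module.End ℂ (ℂ ⊗[ℚ] V)}
    (hQ : Q = α⁻¹ • ((gradingEnd e deg * X.baseChange ℂ * (1 - gradingEnd e deg)) *
          ((1 - gradingEnd e deg) * X.baseChange ℂ * gradingEnd e deg) +
        ((1 - gradingEnd e deg) * X.baseChange ℂ * gradingEnd e deg) *
          (gradingEnd e deg * X.baseChange ℂ * (1 - gradingEnd e deg))))
    {p : Module.End ℚ V} (hpQ : p.baseChange ℂ = Q) (hpp : p * p = p)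
    {T : Module.End ℂ (ℂ ⊗[ℚ] V)}
    (hTE : T * (gradingEnd e deg * X.baseChange ℂ * (1 - gradingEnd e deg)) =
      (gradingEnd e deg * X.baseChange ℂ * (1 - gradingEnd e deg)) * T)
    (hTF : T * ((1 - gradingEnd e deg) * X.baseChange ℂ * gradingEnd e deg) =
      ((1 - gradingEnd e deg) * X.baseChange ℂ * gradingEnd e deg) * T) (hTQ : T * Q = T) :
    T ∈ spanC (Subalgebra.toSubmodule H.endAlg ⊓ LinearMap.ker (LinearMap.mulRight ℚ p - LinearMap.id)) := by
  classical
  subst hn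
  set 𝔡 := Submodule.span ℚ {B | ∃ X ∈ H.hodgeLie, ∃ Y ∈ H.hodgeLie, X * Y - Y * X = B} with h𝔡
  set Cr := Subalgebra.toSubmodule H.endAlg ⊓ LinearMap.ker (LinearMap.mulRight ℚ p - LinearMap.id) with hCrdef
  have hCr : ∀ a, a ∈ Cr ↔ a ∈ H.endAlg ∧ a * p = a := by
    intro a
    simp only [hCrdef, Submodule.mem_inf, Subalgebra.mem_toSubmodule, LinearMap.mem_ker, LinearMap.sub_apply,
      LinearMap.mulRight_apply, LinearMap.id_coe, id_eq, sub_eq_zero]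
  obtain ⟨-, -, -, hPQ, -, -, -, -, -, -, -, hζQ, -⟩ := projector_identities H rfl e hF hFc hdeg hX hα hζ₀ hEF hQ
  set P := gradingEnd e deg with hP
  set Y := X.baseChange ℂ with hY
  set E := P * Y * (1 - P) with hEdef
  set F := (1 - P) * Y * P with hFdef
  have hPP : P * P = P := gradingEnd_mul_gradingEnd_of_deg e hdeg
  have hYM : Y ∈ H.hodgeLieC := H.baseChange_mem_hodgeLieC hX
  obtain ⟨hEM, hFM⟩ := projE_mem_hodgeLieC H e hF hFc hdeg hYM
  rw [← hP, ← hEdef] at hEM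
  rw [← hP, ← hFdef] at hFM
  -- rational brackets
  set brk : Set (Module.End ℚ V) := (fun q : Module.End ℚ V × Module.End ℚ V => q.1 * q.2 - q.2 * q.1) ''
    ((H.hodgeLie : Set (Module.End ℚ V)) ×ˢ (H.hodgeLie : Set (Module.End ℚ V))) with hbrk
  have hbrk𝔡 : ∀ s ∈ brk, s ∈ 𝔡 := by
    rintro _ ⟨⟨X₁, X₂⟩, ⟨hX₁, hX₂⟩, rfl⟩
    exact Submodule.subset_span ⟨X₁, hX₁, X₂, hX₂, rfl⟩
  -- for `b` commuting with the brackets, `b_ℂ Q = (b p)_ℂ` with `b p ∈ Cr`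
  have hb : ∀ b : Module.End ℚ V, (∀ s ∈ brk, b * s = s * b) → b.baseChange ℂ * Q ∈ spanC Cr := by
    intro b hb
    have hb𝔡 : ∀ D ∈ 𝔡, b * D = D * b := by
      intro D hD
      induction hD using Submodule.span_induction with
      | mem s hs =>
        obtain ⟨X₁, hX₁, X₂, hX₂, rfl⟩ := hs
        exact hb _ ⟨(X₁, X₂), ⟨hX₁, hX₂⟩, rfl⟩
      | zero => rw [mul_zero, zero_mul]
      | add x y _ _ hx hy => rw [mul_add, add_mul, hx, hy]
      | smul c x _ hx => rw [mul_smul_comm, smul_mul_assoc, hx]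
    have hbC : ∀ D ∈ spanC 𝔡, b.baseChange ℂ * D = D * b.baseChange ℂ := by
      intro D hD
      unfold spanC at hD
      induction hD using Submodule.span_induction with
      | mem D' hD' =>
        obtain ⟨D₀, hD₀, rfl⟩ := hD'
        rw [← LinearMap.baseChange_mul, hb𝔡 D₀ hD₀, LinearMap.baseChange_mul]
      | zero => rw [mul_zero, zero_mul]
      | add x y _ _ hx hy => rw [mul_add, add_mul, hx, hy]
      | smul c x _ hx => rw [mul_smul_comm, smul_mul_assoc, hx]
    obtain ⟨hEd, hFd⟩ := projE_mem_spanC_derived H rfl e hF hFc hdeg hX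
    rw [← hP, ← hY, ← hEdef] at hEd
    rw [← hP, ← hY, ← hFdef] at hFd
    set β := b.baseChange ℂ with hβ
    have hbE : β * E = E * β := hbC E hEd
    have hbF : β * F = F * β := hbC F hFd
    have hbB : β * (E * F - F * E) = (E * F - F * E) * β := hbC _ (bracket_mem_spanC_derived H hEM hFM)
    have hbQ : β * Q = Q * β := by
      rw [hQ, mul_smul_comm, smul_mul_assoc, mul_add, add_mul, ← mul_assoc β E F, hbE, mul_assoc E β F, hbF,
        ← mul_assoc E F β, ← mul_assoc β F E, hbF, mul_assoc F β E, hbE, ← mul_assoc F E β]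
    have hbr : α • (β * ((2 : ℂ) • P - 1) - ((2 : ℂ) • P - 1) * β) = ζ₀ * β - β * ζ₀ := by
      have h := hbB
      rw [hEF, mul_add, add_mul, mul_smul_comm, smul_mul_assoc] at h
      rw [smul_sub]
      have h' := sub_eq_zero.2 h
      apply eq_of_sub_eq_zero
      rw [← sub_eq_zero.1 (show α • (β * ((2 : ℂ) • P - 1)) + β * ζ₀ - (α • (((2 : ℂ) • P - 1) * β) + ζ₀ * β) -
        (α • (β * ((2 : ℂ) • P - 1)) - α • (((2 : ℂ) • P - 1) * β) - (ζ₀ * β - β * ζ₀)) = 0 by abel)]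
      exact h'
    have hbrQ : (β * ((2 : ℂ) • P - 1) - ((2 : ℂ) • P - 1) * β) * Q = 0 := by
      have h : (α • (β * ((2 : ℂ) • P - 1) - ((2 : ℂ) • P - 1) * β)) * Q = 0 := by
        rw [hbr, sub_mul, mul_assoc ζ₀ β Q, hbQ, ← mul_assoc ζ₀ Q β, hζQ, zero_mul, mul_assoc β ζ₀ Q, hζQ, mul_zero,
          sub_zero]
      rw [smul_mul_assoc] at h
      exact (smul_eq_zero.1 h).resolve_left hα
    have hQΘ : Q * ((2 : ℂ) • P - 1) = ((2 : ℂ) • P - 1) * Q := by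
      rw [mul_sub, sub_mul, mul_smul_comm, smul_mul_assoc, ← hPQ, mul_one, one_mul]
    have hb'Θ : (β * Q) * ((2 : ℂ) • P - 1) = ((2 : ℂ) • P - 1) * (β * Q) := by
      rw [mul_assoc β Q _, hQΘ, ← mul_assoc β _ Q]
      have h := hbrQ
      rw [sub_mul, sub_eq_zero] at h
      rw [h, mul_assoc]
    have hb'P : (β * Q) * P = P * (β * Q) := by
      rw [mul_sub (β * Q) _ 1, sub_mul _ 1 (β * Q), mul_one, one_mul, mul_smul_comm, smul_mul_assoc, sub_left_inj] at hb'Θ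
      exact smul_right_injective _ (two_ne_zero' ℂ) hb'Θ
    have hbpC : (b * p).baseChange ℂ = β * Q := by rw [LinearMap.baseChange_mul, hpQ]
    have hbpA : b * p ∈ H.endAlg := by
      have hc : (b * p).baseChange ℂ * P = P * (b * p).baseChange ℂ := by rw [hbpC, hb'P]
      exact mem_endAlg_of_projE_eq_zero H e hF hdeg (blocks_D hPP hc).1 (blocks_D hPP hc).2
    have hbpCr : b * p ∈ Cr := (hCr _).2 ⟨hbpA, by rw [mul_assoc, hpp]⟩
    rw [← hbpC]
    exact baseChange_mem_spanC hbpCr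
  -- `T` commutes with the rational brackets, hence descends
  have hTB : T * (E * F - F * E) = (E * F - F * E) * T := by
    rw [mul_sub, sub_mul, ← mul_assoc T E F, hTE, mul_assoc E T F, hTF, ← mul_assoc E F T, ← mul_assoc T F E, hTF,
      mul_assoc F T E, hTE, ← mul_assoc F E T]
  have hTs : ∀ s ∈ brk, T * s.baseChange ℂ = s.baseChange ℂ * T := by
    intro s hs
    obtain ⟨c, hc⟩ := exists_coeffs_of_mem_spanC_derived H ψ rfl e hF hFc hdeg hX hXE h3
      (baseChange_mem_spanC (hbrk𝔡 s hs))
    rw [← hP, ← hY, ← hEdef, ← hFdef] at hc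
    rw [hc]
    simp only [mul_add, add_mul, mul_smul_comm, smul_mul_assoc, hTE, hTF, hTB]
  have hTmem := mem_span_baseChange_of_forall_commute brk hTs
  have hTQmem : T * Q ∈ spanC Cr := by
    refine Submodule.span_induction (p := fun T _ => T * Q ∈ spanC Cr) ?_ ?_ ?_ ?_ hTmem
    · rintro _ ⟨b, hb', rfl⟩
      exact hb b hb'
    · rw [zero_mul]; exact Submodule.zero_mem _
    · intro x y _ _ hx hy
      rw [add_mul]; exact Submodule.add_mem _ hx hy
    · intro c x _ hx
      rw [smul_mul_assoc]; exact Submodule.smul_mem _ c hx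
  rw [hTQ] at hTQmem
  exact hTQmem

end HodgeStructure

end Literature.AlgebraicGeometry.Motives

end
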